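import Literature.MathematicalPhysics.QuantumLattice.HubbardTTPrimeUBoxWords
import HarnessLib

/-!
# Single-anchor transport of a `t–t'` window certificate to ANY point of the `(t', U)` half-plane:
# the exact first-order identity, its torus-limit soundness, and the priced (Lipschitz) forms

Family `hubbard` (topic `MathematicalPhysics/QuantumLattice`); the two-coupling companion of
`HubbardTTPrimeUBoxWords` §3–§4 (the `U`-ray), written for the material-oracle stage S2 (cell
`pub/hubbard-downfold`, seat unc-1: a downfolded parameter BOX in `(t'/t, U/t)` must inherit the certified
words of the nearest anchor). The `t–t'–U` interaction is affine in the couplings,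
`Φ(t,t'_A,U_A) = Φ(t,t'_P,U_P) + (t'_A − t'_P) Φ(0,1,0) + (U_A − U_P) Φ(0,0,1)`
(`hubbardTTPrimeFermionInteraction_taylor`), so a window identity issued at the anchor `A` — objective `Xw`,
constant `c`, cap `u`, energy multiplier `κ`, Gram data, eom generators `Bₖ`, symmetry / charged / residual
blocks — IS a window identity at ANY target `P` with the same data, objective
`Xw + (t'_A − t'_P)(κ ΓE_{Φ(0,1,0)} − Σₖ[H_{Λ'}(0,1,0), ΓBₖ]) + (U_A − U_P)(κ ΓE_{Φ(0,0,1)} − Σₖ[H_{Λ'}(0,0,1), ΓBₖ])`,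
constant `c + κ(u − u')` and cap `u'` (`windowCertificate_TT'_transport`, §1). One application of the tree's
soundness theorem `IsTorusLimitOf.re_expect_ge_of_window_certificate_TT'_ineq` AT THE TARGET gives (§2), for
every torus-limit ground state `ω` at `P` (`U_P ≥ 0`, certified cap `e(t,t'_P,U_P,n) ≤ u'`):

  `c + κ(u − u') − Σₖ‖aₖ‖ + (Σ_σ μ_σ)(n/2 − ν) − κ[(t'_A − t'_P) K₂(ω) + (U_A − U_P) D(ω)]
     + (t'_A − t'_P) Re ω(W_{t'}) + (U_A − U_P) Re ω(W_U) ≤ Re ω_{Λ'}(Xw)`,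

`K₂(ω) = e_{Φ(0,1,0)}(ω)`, `D(ω) = Re ω(n_{0↑}n_{0↓})`, `W_{t'} = Σₖ[H_{Λ'}(0,1,0), ΓBₖ]`,
`W_U = Σₖ[H_{Λ'}(0,0,1), ΓBₖ]` (the "coupling charges" of the eom rows). §3 prices the four conjugate
terms by certified brackets `K₂(ω) ∈ [τlo, τhi]`, `D(ω) ∈ [dlo, dhi]` (e.g. the box brackets of
`HubbardTTPrimeUBoxWords` §2, the chords of `HubbardTTPrimeCapCutDualRows` §8–§9) and operator norms of the
charges (`…_transport_priced`); §4 is the a-priori LIPSCHITZ form with the kinematic ranges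
`D ∈ [0, (n/2)²]`, `|K₂| ≤ 16/π²` (`…_transport_lipschitz`): the anchor word degrades by
`|t'_A − t'_P|·(16κ/π² + ‖W_{t'}‖) + |U_A − U_P|·(κ(n/2)² + ‖W_U‖)` plus the cap re-booking `κ(u − u')`.
Relation to the corner-hull box certificates (`HubbardTTPrimeWindowCertificateConvexComb`,
`BoxDualCovarianceCombination`): those interpolate between certificates at corners on both sides of the
target and expand the charges on the word dictionary; here ONE certificate is moved anywhere (inside or
outside any hull) and the charges stay explicit operators.

HONEST SCOPE: transport lemmas only — no number, no new certificate, no claim on the Hubbard ground state;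
translation-only reduction (`γₗ = 1`) and the charged-word caveat of the parent theorem unchanged.
Everything is PROVED; no definition, no named fact, no numerical input.

## Mathlib / tree search

REUSED: `hubbardTTPrimeFermionInteraction_taylor`, `FermionInteraction.localHamiltonian_of_add_smul_smul`,
`FermionInteraction.meanEnergyObs_of_add_smul_smul`, `commutator_add_smul_smul_expand`
(`BoxDualCovarianceCombination` §1), `IsTorusLimitOf.re_expect_ge_of_window_certificate_TT'_ineq`,
`IsTorusLimitOf.meanEnergy_onSite_eq_re_expect_docc`, `IsTorusLimitOf.abs_meanEnergy_diagHop_le`,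
`IsTorusLimitOf.re_expect_docc_le_sq_half_density_of_groundState`, `re_expect_docc_nonneg`, `abs_re_expect_le`.
`lean search 'transport.*window_certificate'`: only `HubbardTTPrimeUBoxWords` (the `U`-ray).

## References

* J. Wang et al., PRX 14 (2024) 031006, §III (observable bounds under an energy constraint). [cite: WangEtAl2024, §III]
* X. Han, arXiv:2006.06002 (2020), §3 (square-lattice constraint families). [cite: Han2020Bootstrap, §3]
* T. Koma, H. Tasaki, J. Stat. Phys. 76 (1994) 745, §1 (conjugate observables of linear couplings).
  [cite: KomaTasaki1994, §1]
* E. H. Lieb, M. Loss, Duke Math. J. 71 (1993) 337, §8 Thm. 8.2 (bathtub: the kinematic hopping range).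
  [cite: LiebLoss1993, §8, Theorem 8.2]
-/

noncomputable section

namespace Literature.MathematicalPhysics.QuantumLattice

open Matrix Finset HubbardWave0 Literature.Probability.LatticeModels ThermodynamicLimit
open Literature.MathematicalPhysics.QuantumManyBody.StateRelaxation
open _root_.Filter
open scoped _root_.Topology ComplexOrder BigOperators

/-! ### §1 The exact transport identity to any target `(t'_P, U_P)` -/

/-- **Two-coupling transport identity of a `t–t'` window certificate.** A window identity at the anchor
`(t, t'_A, U_A)` (objective `Xw`, constant `c`, cap `u`, multiplier `κ`, Gram part `G`, eom rows with
generators `Bₖ`, coupling-independent blocks `SY`, `R`) is, for every target `(t'_P, U_P)` and cap `u'`,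
a window identity at `(t, t'_P, U_P)` with objective
`Xw + (t'_A − t'_P)·(κ ΓE_{Φ(0,1,0)} − Σₖ (H_{Λ'}(0,1,0) ΓBₖ − ΓBₖ H_{Λ'}(0,1,0)))
    + (U_A − U_P)·(κ ΓE_{Φ(0,0,1)} − Σₖ (H_{Λ'}(0,0,1) ΓBₖ − ΓBₖ H_{Λ'}(0,0,1)))`
and constant `c + κ(u − u')` — because the interaction, hence the local Hamiltonians, the mean-energy
observable and the eom rows, are affine in `(t', U)`. [cite: WangEtAl2024, §III] -/
theorem windowCertificate_TT'_transport (t t'A UA t'P UP : ℝ)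
    {Λ Λ' : Finset (Site 2)} (hΛ : Λ ⊆ Λ') (h0 : thicken ({0} : Finset (Site 2)) 1 ⊆ Λ')
    (hz : (0 : Site 2) ∈ Λ') (Xw : FermionOp Λ') (κ u u' : ℝ) (μ : Fin 2 → ℝ) (ν : ℝ)
    (G SY R : FermionOp Λ') {κ' : Type*} (s : Finset κ') (B : κ' → FermionOp Λ) {c : ℝ}
    (hcert : Xw - (c : ℂ) • (1 : FermionOp Λ') -
        ∑ σ : Fin 2, ((μ σ : ℝ) : ℂ) • (nAt 0 hz σ - ((ν : ℝ) : ℂ) • (1 : FermionOp Λ')) -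
        ((κ : ℝ) : ℂ) • (((u : ℝ) : ℂ) • (1 : FermionOp Λ') -
          fermionEmbed (PolySite.incl h0) ((hubbardTTPrimeFermionInteraction t t'A UA).meanEnergyObs 1)) =
      G +
        (∑ k ∈ s, ((hubbardTTPrimeFermionInteraction t t'A UA).localHamiltonian Λ' *
              fermionEmbed (PolySite.incl hΛ) (B k) -
            fermionEmbed (PolySite.incl hΛ) (B k) * (hubbardTTPrimeFermionInteraction t t'A UA).localHamiltonian Λ') +
          SY) + R) :
    (Xw + ((t'A - t'P : ℝ) : ℂ) •
        (((κ : ℝ) : ℂ) • fermionEmbed (PolySite.incl h0) ((hubbardTTPrimeFermionInteraction 0 1 0).meanEnergyObs 1) -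
          ∑ k ∈ s, ((hubbardTTPrimeFermionInteraction 0 1 0).localHamiltonian Λ' *
              fermionEmbed (PolySite.incl hΛ) (B k) -
            fermionEmbed (PolySite.incl hΛ) (B k) * (hubbardTTPrimeFermionInteraction 0 1 0).localHamiltonian Λ')) +
      ((UA - UP : ℝ) : ℂ) •
        (((κ : ℝ) : ℂ) • fermionEmbed (PolySite.incl h0) ((hubbardTTPrimeFermionInteraction 0 0 1).meanEnergyObs 1) -
          ∑ k ∈ s, ((hubbardTTPrimeFermionInteraction 0 0 1).localHamiltonian Λ' *
              fermionEmbed (PolySite.incl hΛ) (B k) -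
            fermionEmbed (PolySite.incl hΛ) (B k) * (hubbardTTPrimeFermionInteraction 0 0 1).localHamiltonian Λ'))) -
        ((c + κ * (u - u') : ℝ) : ℂ) • (1 : FermionOp Λ') -
        ∑ σ : Fin 2, ((μ σ : ℝ) : ℂ) • (nAt 0 hz σ - ((ν : ℝ) : ℂ) • (1 : FermionOp Λ')) -
        ((κ : ℝ) : ℂ) • (((u' : ℝ) : ℂ) • (1 : FermionOp Λ') -
          fermionEmbed (PolySite.incl h0) ((hubbardTTPrimeFermionInteraction t t'P UP).meanEnergyObs 1)) =
      G +
        (∑ k ∈ s, ((hubbardTTPrimeFermionInteraction t t'P UP).localHamiltonian Λ' *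
              fermionEmbed (PolySite.incl hΛ) (B k) -
            fermionEmbed (PolySite.incl hΛ) (B k) * (hubbardTTPrimeFermionInteraction t t'P UP).localHamiltonian Λ') +
          SY) + R := by
  -- the interaction at the anchor, expanded at the target
  have hΦ : ∀ X, (hubbardTTPrimeFermionInteraction t t'A UA).Φ X =
      (hubbardTTPrimeFermionInteraction t t'P UP).Φ X +
        ((t'A - t'P : ℝ) : ℂ) • (hubbardTTPrimeFermionInteraction 0 1 0).Φ X +
        ((UA - UP : ℝ) : ℂ) • (hubbardTTPrimeFermionInteraction 0 0 1).Φ X :=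
    fun X => hubbardTTPrimeFermionInteraction_taylor t t'A UA t'P UP X
  have hH := FermionInteraction.localHamiltonian_of_add_smul_smul hΦ Λ'
  have hE := FermionInteraction.meanEnergyObs_of_add_smul_smul hΦ 1
  -- abbreviations
  set HP : FermionOp Λ' := (hubbardTTPrimeFermionInteraction t t'P UP).localHamiltonian Λ' with hHP
  set HT : FermionOp Λ' := (hubbardTTPrimeFermionInteraction 0 1 0).localHamiltonian Λ' with hHT
  set HD : FermionOp Λ' := (hubbardTTPrimeFermionInteraction 0 0 1).localHamiltonian Λ' with hHD
  set EP := (hubbardTTPrimeFermionInteraction t t'P UP).meanEnergyObs 1 with hEP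
  set ET := (hubbardTTPrimeFermionInteraction 0 1 0).meanEnergyObs 1 with hET
  set ED := (hubbardTTPrimeFermionInteraction 0 0 1).meanEnergyObs 1 with hED
  set a : ℂ := ((t'A - t'P : ℝ) : ℂ) with ha
  set b : ℂ := ((UA - UP : ℝ) : ℂ) with hb
  -- the eom block splits
  have hN : ∑ k ∈ s, ((hubbardTTPrimeFermionInteraction t t'A UA).localHamiltonian Λ' *
        fermionEmbed (PolySite.incl hΛ) (B k) -
      fermionEmbed (PolySite.incl hΛ) (B k) * (hubbardTTPrimeFermionInteraction t t'A UA).localHamiltonian Λ') =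
      ∑ k ∈ s, (HP * fermionEmbed (PolySite.incl hΛ) (B k) - fermionEmbed (PolySite.incl hΛ) (B k) * HP) +
        a • ∑ k ∈ s, (HT * fermionEmbed (PolySite.incl hΛ) (B k) - fermionEmbed (PolySite.incl hΛ) (B k) * HT) +
        b • ∑ k ∈ s, (HD * fermionEmbed (PolySite.incl hΛ) (B k) - fermionEmbed (PolySite.incl hΛ) (B k) * HD) := by
    rw [Finset.smul_sum, Finset.smul_sum, ← Finset.sum_add_distrib, ← Finset.sum_add_distrib]
    refine Finset.sum_congr rfl fun k _ => ?_
    rw [hH]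
    exact commutator_add_smul_smul_expand HP HT HD _ a b
  rw [hN, hE, map_add, map_add, map_smul, map_smul] at hcert
  -- regroup: the target identity is the anchor identity with the conjugate terms moved to the left
  have key : Xw + a • (((κ : ℝ) : ℂ) • fermionEmbed (PolySite.incl h0) ET -
          ∑ k ∈ s, (HT * fermionEmbed (PolySite.incl hΛ) (B k) - fermionEmbed (PolySite.incl hΛ) (B k) * HT)) +
        b • (((κ : ℝ) : ℂ) • fermionEmbed (PolySite.incl h0) ED -
          ∑ k ∈ s, (HD * fermionEmbed (PolySite.incl hΛ) (B k) - fermionEmbed (PolySite.incl hΛ) (B k) * HD)) -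
        ((c + κ * (u - u') : ℝ) : ℂ) • (1 : FermionOp Λ') -
        ∑ σ : Fin 2, ((μ σ : ℝ) : ℂ) • (nAt 0 hz σ - ((ν : ℝ) : ℂ) • (1 : FermionOp Λ')) -
        ((κ : ℝ) : ℂ) • (((u' : ℝ) : ℂ) • (1 : FermionOp Λ') - fermionEmbed (PolySite.incl h0) EP) =
      (Xw - (c : ℂ) • (1 : FermionOp Λ') -
        ∑ σ : Fin 2, ((μ σ : ℝ) : ℂ) • (nAt 0 hz σ - ((ν : ℝ) : ℂ) • (1 : FermionOp Λ')) -
        ((κ : ℝ) : ℂ) • (((u : ℝ) : ℂ) • (1 : FermionOp Λ') -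
          (fermionEmbed (PolySite.incl h0) EP + a • fermionEmbed (PolySite.incl h0) ET +
            b • fermionEmbed (PolySite.incl h0) ED))) -
        a • ∑ k ∈ s, (HT * fermionEmbed (PolySite.incl hΛ) (B k) - fermionEmbed (PolySite.incl hΛ) (B k) * HT) -
        b • ∑ k ∈ s, (HD * fermionEmbed (PolySite.incl hΛ) (B k) - fermionEmbed (PolySite.incl hΛ) (B k) * HD) := by
    push_cast
    module
  rw [key, hcert]
  module

/-! ### §2 Soundness at the target: explicit conjugate terms -/

namespace InfVolFermionState

/-- **One certificate at `(t'_A, U_A)` bounds the objective in the torus-limit ground states at any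
`(t'_P, U_P)`.** Data: the translation-reduced window identity of
`IsTorusLimitOf.re_expect_ge_of_window_certificate_TT'_ineq` issued at the anchor `(t, t'_A, U_A)` with
`κ ≥ 0`; a target `U_P ≥ 0`, `0 ≤ n < 2`, a certified cap `e(t,t'_P,U_P,n) ≤ u'`; `ω` a torus limit of unit
`(rectN n (Ls j), S^z = 0)` sector ground states of `hubbardTorusTT' (Ls j) t t'_P U_P`, `Ls → ∞`. Then
`c + κ(u − u') − Σₖ ‖aₖ‖ + (Σ_σ μ_σ)(n/2 − ν) − (t'_A − t'_P) κ K₂(ω) − (U_A − U_P) κ Re ω(n_{0↑}n_{0↓})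
   + (t'_A − t'_P) Re ω_{Λ'}(W_{t'}) + (U_A − U_P) Re ω_{Λ'}(W_U) ≤ Re ω_{Λ'}(Xw)`,
`K₂(ω) = ω.meanEnergy Φ(0,1,0) 1`, `W_{t'} = Σₖ (H_{Λ'}(0,1,0) ΓBₖ − ΓBₖ H_{Λ'}(0,1,0))`,
`W_U = Σₖ (H_{Λ'}(0,0,1) ΓBₖ − ΓBₖ H_{Λ'}(0,0,1))`. [cite: WangEtAl2024, §III] [cite: KomaTasaki1994, §1] -/
theorem IsTorusLimitOf.re_expect_ge_of_window_certificate_TT'_ineq_transport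
    (t t'A UA t'P : ℝ) {UP : ℝ} (hUP : 0 ≤ UP) {n : ℝ} (hn0 : 0 ≤ n) (hn2 : n < 2) {κ u u' : ℝ}
    (hκ : 0 ≤ κ) (hu' : ThermodynamicLimit.energyDensityTT' t t'P UP n ≤ u')
    {Λ Λ' : Finset (Site 2)} (hΛ : Λ ⊆ Λ') (h8 : thicken Λ 1 ⊆ Λ')
    (h0 : thicken ({0} : Finset (Site 2)) 1 ⊆ Λ') (hz : (0 : Site 2) ∈ Λ')
    (Xw : FermionOp Λ') (μ : Fin 2 → ℝ) (ν : ℝ)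
    {m : Type*} [Fintype m] [DecidableEq m] {Λm : Matrix m m ℂ} (hΛm : Λm.PosSemidef)
    (O : m → FermionOp Λ')
    {κ' : Type*} (s : Finset κ') (B : κ' → FermionOp Λ)
    {ι : Type*} (tt : Finset ι) (γ : ι → DihedralGroup 4) (hγ1 : ∀ l ∈ tt, γ l = 1) (wv : ι → Site 2)
    (hsh : ∀ l, d4ShiftSet (γ l) (wv l) Λ ⊆ Λ') (Y : ι → FermionOp Λ)
    {ρ : Type*} (uu : Finset ρ) (b : ρ → ℂ) (cw : ρ → List (Orb (PolySite Λ') × Bool))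
    (hcw : ∀ j ∈ uu, ladderCharge (cw j) ≠ 0 ∨ ladderSpinCharge (cw j) ≠ 0)
    {δ : Type*} (ah : Finset δ) (dc : δ → ℝ) (V : δ → FermionOp Λ')
    {κ'' : Type*} (w : Finset κ'') (a : κ'' → ℂ) (word : κ'' → List (Orb (PolySite Λ') × Bool)) {c : ℝ}
    (hcert : Xw - (c : ℂ) • (1 : FermionOp Λ') -
        ∑ σ : Fin 2, ((μ σ : ℝ) : ℂ) • (nAt 0 hz σ - ((ν : ℝ) : ℂ) • (1 : FermionOp Λ')) -
        ((κ : ℝ) : ℂ) • (((u : ℝ) : ℂ) • (1 : FermionOp Λ') -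
          fermionEmbed (PolySite.incl h0) ((hubbardTTPrimeFermionInteraction t t'A UA).meanEnergyObs 1)) =
      gramForm Λm O +
        (∑ k ∈ s, ((hubbardTTPrimeFermionInteraction t t'A UA).localHamiltonian Λ' * fermionEmbed (PolySite.incl hΛ) (B k) -
            fermionEmbed (PolySite.incl hΛ) (B k) * (hubbardTTPrimeFermionInteraction t t'A UA).localHamiltonian Λ') +
          ∑ l ∈ tt, (fermionEmbed (PolySite.incl (hsh l)) (fermionEmbed (PolySite.d4Emb (γ l) (wv l) Λ) (Y l)) -
            fermionEmbed (PolySite.incl hΛ) (Y l)) +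
          ∑ j ∈ uu, b j • ladderWord (cw j)) +
        (∑ m' ∈ ah, ((dc m' : ℝ) : ℂ) • ((V m')ᴴ - V m') + ∑ k ∈ w, a k • ladderWord (word k)))
    {Ls : ℕ → ℕ} (hLs : Tendsto Ls atTop atTop)
    {ψ : ∀ L, Fock (Orb (FermionTorus 2 L))}
    (hψ : ∀ j, IsGroundStateInSector (hubbardTorusTT' (Ls j) t t'P UP)
      (ThermodynamicLimit.rectN n (Ls j)) 0 (ψ (Ls j)))
    (hψ1 : ∀ j, star (ψ (Ls j)) ⬝ᵥ ψ (Ls j) = 1)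
    {ω : InfVolFermionState 2} (hω : ω.IsTorusLimitOf ψ Ls) :
    c + κ * (u - u') - ∑ k ∈ w, ‖a k‖ + (∑ σ : Fin 2, μ σ) * (n / 2 - ν) -
        (t'A - t'P) * κ * ω.meanEnergy (hubbardTTPrimeFermionInteraction 0 1 0) 1 -
        (UA - UP) * κ * (ω.expect ({0} : Finset (Site 2))
          (nAt 0 (Finset.mem_singleton_self 0) 0 * nAt 0 (Finset.mem_singleton_self 0) 1)).re +
        (t'A - t'P) * (ω.expect Λ' (∑ k ∈ s,
          ((hubbardTTPrimeFermionInteraction 0 1 0).localHamiltonian Λ' * fermionEmbed (PolySite.incl hΛ) (B k) -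
            fermionEmbed (PolySite.incl hΛ) (B k) * (hubbardTTPrimeFermionInteraction 0 1 0).localHamiltonian Λ'))).re +
        (UA - UP) * (ω.expect Λ' (∑ k ∈ s,
          ((hubbardTTPrimeFermionInteraction 0 0 1).localHamiltonian Λ' * fermionEmbed (PolySite.incl hΛ) (B k) -
            fermionEmbed (PolySite.incl hΛ) (B k) * (hubbardTTPrimeFermionInteraction 0 0 1).localHamiltonian Λ'))).re ≤
      (ω.expect Λ' Xw).re := by
  -- the transported identity at `(t'_P, U_P)`
  have hcert' := windowCertificate_TT'_transport t t'A UA t'P UP hΛ h0 hz Xw κ u u' μ ν (gramForm Λm O)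
    (∑ l ∈ tt, (fermionEmbed (PolySite.incl (hsh l)) (fermionEmbed (PolySite.d4Emb (γ l) (wv l) Λ) (Y l)) -
        fermionEmbed (PolySite.incl hΛ) (Y l)) +
      ∑ j ∈ uu, b j • ladderWord (cw j))
    (∑ m' ∈ ah, ((dc m' : ℝ) : ℂ) • ((V m')ᴴ - V m') + ∑ k ∈ w, a k • ladderWord (word k)) s B
    (c := c) (by rw [hcert]; abel)
  -- the tree's soundness theorem at the target, applied to the transported identity
  have hmain := hω.re_expect_ge_of_window_certificate_TT'_ineq t t'P hUP hn0 hn2 hκ hu' hΛ h8 h0 hz _ μ ν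
    hΛm O s B tt γ hγ1 wv hsh Y uu b cw hcw ah dc V w a word (c := c + κ * (u - u'))
    (by rw [hcert']; abel) hLs hψ hψ1
  -- read the transported objective in `ω`
  have hED : (ω.expect Λ' (fermionEmbed (PolySite.incl h0)
      ((hubbardTTPrimeFermionInteraction 0 0 1).meanEnergyObs 1))).re =
      (ω.expect ({0} : Finset (Site 2))
        (nAt 0 (Finset.mem_singleton_self 0) 0 * nAt 0 (Finset.mem_singleton_self 0) 1)).re := by
    rw [ω.compatible h0, ← hω.meanEnergy_onSite_eq_re_expect_docc hLs]
    rfl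
  have hET : (ω.expect Λ' (fermionEmbed (PolySite.incl h0)
      ((hubbardTTPrimeFermionInteraction 0 1 0).meanEnergyObs 1))).re =
      ω.meanEnergy (hubbardTTPrimeFermionInteraction 0 1 0) 1 := by
    rw [ω.compatible h0]
    rfl
  have hread : (ω.expect Λ' (Xw + ((t'A - t'P : ℝ) : ℂ) •
      (((κ : ℝ) : ℂ) • fermionEmbed (PolySite.incl h0) ((hubbardTTPrimeFermionInteraction 0 1 0).meanEnergyObs 1) -
        ∑ k ∈ s, ((hubbardTTPrimeFermionInteraction 0 1 0).localHamiltonian Λ' * fermionEmbed (PolySite.incl hΛ) (B k) -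
          fermionEmbed (PolySite.incl hΛ) (B k) * (hubbardTTPrimeFermionInteraction 0 1 0).localHamiltonian Λ')) +
      ((UA - UP : ℝ) : ℂ) •
      (((κ : ℝ) : ℂ) • fermionEmbed (PolySite.incl h0) ((hubbardTTPrimeFermionInteraction 0 0 1).meanEnergyObs 1) -
        ∑ k ∈ s, ((hubbardTTPrimeFermionInteraction 0 0 1).localHamiltonian Λ' * fermionEmbed (PolySite.incl hΛ) (B k) -
          fermionEmbed (PolySite.incl hΛ) (B k) * (hubbardTTPrimeFermionInteraction 0 0 1).localHamiltonian Λ')))).re =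
      (ω.expect Λ' Xw).re +
        (t'A - t'P) * (κ * ω.meanEnergy (hubbardTTPrimeFermionInteraction 0 1 0) 1 -
          (ω.expect Λ' (∑ k ∈ s,
            ((hubbardTTPrimeFermionInteraction 0 1 0).localHamiltonian Λ' * fermionEmbed (PolySite.incl hΛ) (B k) -
              fermionEmbed (PolySite.incl hΛ) (B k) * (hubbardTTPrimeFermionInteraction 0 1 0).localHamiltonian Λ'))).re) +
        (UA - UP) * (κ * (ω.expect ({0} : Finset (Site 2))
          (nAt 0 (Finset.mem_singleton_self 0) 0 * nAt 0 (Finset.mem_singleton_self 0) 1)).re -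
          (ω.expect Λ' (∑ k ∈ s,
            ((hubbardTTPrimeFermionInteraction 0 0 1).localHamiltonian Λ' * fermionEmbed (PolySite.incl hΛ) (B k) -
              fermionEmbed (PolySite.incl hΛ) (B k) * (hubbardTTPrimeFermionInteraction 0 0 1).localHamiltonian Λ'))).re) := by
    rw [map_add, map_add, Complex.add_re, Complex.add_re, map_smul, smul_eq_mul, Complex.re_ofReal_mul, map_sub,
      Complex.sub_re, map_smul, smul_eq_mul, Complex.re_ofReal_mul, hET, map_smul, smul_eq_mul,
      Complex.re_ofReal_mul, map_sub, Complex.sub_re, map_smul, smul_eq_mul, Complex.re_ofReal_mul, hED]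
  rw [hread] at hmain
  linarith

/-! ### §3 Priced form: certified brackets for the conjugate observables, norms for the charges -/

/-- Sign-split pricing of a slope term: `x κ τ ≤ max (x κ τlo) (x κ τhi)` for `κ ≥ 0`, `τ ∈ [τlo, τhi]`.
[folklore] [cite: KomaTasaki1994, §1] -/
private theorem mul_mul_le_max_of_mem {x κ τ τlo τhi : ℝ} (hκ : 0 ≤ κ) (hlo : τlo ≤ τ) (hhi : τ ≤ τhi) :
    x * κ * τ ≤ max (x * κ * τlo) (x * κ * τhi) := by
  rcases le_total 0 x with hp | hm
  · exact (mul_le_mul_of_nonneg_left hhi (mul_nonneg hp hκ)).trans (le_max_right _ _)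
  · exact (mul_le_mul_of_nonpos_left hlo (mul_nonpos_of_nonpos_of_nonneg hm hκ)).trans (le_max_left _ _)

open scoped Matrix.Norms.L2Operator in
/-- Norm pricing of a charge term: `−|x| ‖W‖ ≤ x Re ω(W)`. [cite: BratteliRobinsonI1987, Prop. 2.3.11] -/
private theorem neg_abs_mul_norm_le_mul_re_expect (ω : InfVolFermionState 2) {Λ' : Finset (Site 2)}
    (x : ℝ) (W : FermionOp Λ') : -(|x| * ‖W‖) ≤ x * (ω.expect Λ' W).re := by
  have h1 : |x * (ω.expect Λ' W).re| ≤ |x| * ‖W‖ := by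
    rw [abs_mul]
    exact mul_le_mul_of_nonneg_left (ω.abs_re_expect_le Λ' W) (abs_nonneg _)
  exact (abs_le.1 h1).1

open scoped Matrix.Norms.L2Operator in
/-- **Priced transport.** Under the hypotheses of `…_transport`, certified brackets for the two conjugate
observables OF `ω` — `K₂(ω) ∈ [τlo, τhi]` (e.g. the box bracket of the diagonal-hopping word, or the
kinematic `|K₂| ≤ 16/π²`) and `Re ω(n_{0↑}n_{0↓}) ∈ [dlo, dhi]` (e.g.
`IsTorusLimitOf.re_expect_docc_mem_Icc_of_mem_Icc_U`, or the chords of `HubbardTTPrimeCapCutDualRows` §8) —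
and the operator norms of the two charges give
`c + κ(u − u') − Σₖ ‖aₖ‖ + (Σ_σ μ_σ)(n/2 − ν)
   − max((t'_A−t'_P)κ τlo, (t'_A−t'_P)κ τhi) − max((U_A−U_P)κ dlo, (U_A−U_P)κ dhi)
   − |t'_A − t'_P| ‖W_{t'}‖ − |U_A − U_P| ‖W_U‖ ≤ Re ω_{Λ'}(Xw)`. [cite: WangEtAl2024, §III] [cite: KomaTasaki1994, §1] -/
theorem IsTorusLimitOf.re_expect_ge_of_window_certificate_TT'_ineq_transport_priced
    (t t'A UA t'P : ℝ) {UP : ℝ} (hUP : 0 ≤ UP) {n : ℝ} (hn0 : 0 ≤ n) (hn2 : n < 2) {κ u u' : ℝ}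
    (hκ : 0 ≤ κ) (hu' : ThermodynamicLimit.energyDensityTT' t t'P UP n ≤ u')
    {Λ Λ' : Finset (Site 2)} (hΛ : Λ ⊆ Λ') (h8 : thicken Λ 1 ⊆ Λ')
    (h0 : thicken ({0} : Finset (Site 2)) 1 ⊆ Λ') (hz : (0 : Site 2) ∈ Λ')
    (Xw : FermionOp Λ') (μ : Fin 2 → ℝ) (ν : ℝ)
    {m : Type*} [Fintype m] [DecidableEq m] {Λm : Matrix m m ℂ} (hΛm : Λm.PosSemidef)
    (O : m → FermionOp Λ')
    {κ' : Type*} (s : Finset κ') (B : κ' → FermionOp Λ)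
    {ι : Type*} (tt : Finset ι) (γ : ι → DihedralGroup 4) (hγ1 : ∀ l ∈ tt, γ l = 1) (wv : ι → Site 2)
    (hsh : ∀ l, d4ShiftSet (γ l) (wv l) Λ ⊆ Λ') (Y : ι → FermionOp Λ)
    {ρ : Type*} (uu : Finset ρ) (b : ρ → ℂ) (cw : ρ → List (Orb (PolySite Λ') × Bool))
    (hcw : ∀ j ∈ uu, ladderCharge (cw j) ≠ 0 ∨ ladderSpinCharge (cw j) ≠ 0)
    {δ : Type*} (ah : Finset δ) (dc : δ → ℝ) (V : δ → FermionOp Λ')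
    {κ'' : Type*} (w : Finset κ'') (a : κ'' → ℂ) (word : κ'' → List (Orb (PolySite Λ') × Bool)) {c : ℝ}
    (hcert : Xw - (c : ℂ) • (1 : FermionOp Λ') -
        ∑ σ : Fin 2, ((μ σ : ℝ) : ℂ) • (nAt 0 hz σ - ((ν : ℝ) : ℂ) • (1 : FermionOp Λ')) -
        ((κ : ℝ) : ℂ) • (((u : ℝ) : ℂ) • (1 : FermionOp Λ') -
          fermionEmbed (PolySite.incl h0) ((hubbardTTPrimeFermionInteraction t t'A UA).meanEnergyObs 1)) =
      gramForm Λm O +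
        (∑ k ∈ s, ((hubbardTTPrimeFermionInteraction t t'A UA).localHamiltonian Λ' * fermionEmbed (PolySite.incl hΛ) (B k) -
            fermionEmbed (PolySite.incl hΛ) (B k) * (hubbardTTPrimeFermionInteraction t t'A UA).localHamiltonian Λ') +
          ∑ l ∈ tt, (fermionEmbed (PolySite.incl (hsh l)) (fermionEmbed (PolySite.d4Emb (γ l) (wv l) Λ) (Y l)) -
            fermionEmbed (PolySite.incl hΛ) (Y l)) +
          ∑ j ∈ uu, b j • ladderWord (cw j)) +
        (∑ m' ∈ ah, ((dc m' : ℝ) : ℂ) • ((V m')ᴴ - V m') + ∑ k ∈ w, a k • ladderWord (word k)))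
    {Ls : ℕ → ℕ} (hLs : Tendsto Ls atTop atTop)
    {ψ : ∀ L, Fock (Orb (FermionTorus 2 L))}
    (hψ : ∀ j, IsGroundStateInSector (hubbardTorusTT' (Ls j) t t'P UP)
      (ThermodynamicLimit.rectN n (Ls j)) 0 (ψ (Ls j)))
    (hψ1 : ∀ j, star (ψ (Ls j)) ⬝ᵥ ψ (Ls j) = 1)
    {ω : InfVolFermionState 2} (hω : ω.IsTorusLimitOf ψ Ls)
    {τlo τhi dlo dhi : ℝ}
    (hτ : τlo ≤ ω.meanEnergy (hubbardTTPrimeFermionInteraction 0 1 0) 1 ∧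
      ω.meanEnergy (hubbardTTPrimeFermionInteraction 0 1 0) 1 ≤ τhi)
    (hd : dlo ≤ (ω.expect ({0} : Finset (Site 2))
        (nAt 0 (Finset.mem_singleton_self 0) 0 * nAt 0 (Finset.mem_singleton_self 0) 1)).re ∧
      (ω.expect ({0} : Finset (Site 2))
        (nAt 0 (Finset.mem_singleton_self 0) 0 * nAt 0 (Finset.mem_singleton_self 0) 1)).re ≤ dhi) :
    c + κ * (u - u') - ∑ k ∈ w, ‖a k‖ + (∑ σ : Fin 2, μ σ) * (n / 2 - ν) -
        max ((t'A - t'P) * κ * τlo) ((t'A - t'P) * κ * τhi) -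
        max ((UA - UP) * κ * dlo) ((UA - UP) * κ * dhi) -
        |t'A - t'P| * ‖∑ k ∈ s,
          ((hubbardTTPrimeFermionInteraction 0 1 0).localHamiltonian Λ' * fermionEmbed (PolySite.incl hΛ) (B k) -
            fermionEmbed (PolySite.incl hΛ) (B k) * (hubbardTTPrimeFermionInteraction 0 1 0).localHamiltonian Λ')‖ -
        |UA - UP| * ‖∑ k ∈ s,
          ((hubbardTTPrimeFermionInteraction 0 0 1).localHamiltonian Λ' * fermionEmbed (PolySite.incl hΛ) (B k) -
            fermionEmbed (PolySite.incl hΛ) (B k) * (hubbardTTPrimeFermionInteraction 0 0 1).localHamiltonian Λ')‖ ≤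
      (ω.expect Λ' Xw).re := by
  have h := hω.re_expect_ge_of_window_certificate_TT'_ineq_transport t t'A UA t'P hUP hn0 hn2 hκ hu' hΛ h8 h0
    hz Xw μ ν hΛm O s B tt γ hγ1 wv hsh Y uu b cw hcw ah dc V w a word hcert hLs hψ hψ1
  have hT := mul_mul_le_max_of_mem (x := t'A - t'P) hκ hτ.1 hτ.2
  have hD := mul_mul_le_max_of_mem (x := UA - UP) hκ hd.1 hd.2
  have hWT := neg_abs_mul_norm_le_mul_re_expect ω (t'A - t'P) (∑ k ∈ s,
    ((hubbardTTPrimeFermionInteraction 0 1 0).localHamiltonian Λ' * fermionEmbed (PolySite.incl hΛ) (B k) -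
      fermionEmbed (PolySite.incl hΛ) (B k) * (hubbardTTPrimeFermionInteraction 0 1 0).localHamiltonian Λ'))
  have hWD := neg_abs_mul_norm_le_mul_re_expect ω (UA - UP) (∑ k ∈ s,
    ((hubbardTTPrimeFermionInteraction 0 0 1).localHamiltonian Λ' * fermionEmbed (PolySite.incl hΛ) (B k) -
      fermionEmbed (PolySite.incl hΛ) (B k) * (hubbardTTPrimeFermionInteraction 0 0 1).localHamiltonian Λ'))
  linarith

/-! ### §4 The a-priori Lipschitz form (kinematic ranges of the conjugate observables) -/

open scoped Matrix.Norms.L2Operator in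
/-- **Lipschitz form in `(t', U)`.** Under the hypotheses of `…_transport` with `U_P > 0`, the kinematic
ranges `0 ≤ Re ω(n_{0↑}n_{0↓}) ≤ (n/2)²` (`re_expect_docc_nonneg`,
`IsTorusLimitOf.re_expect_docc_le_sq_half_density_of_groundState`) and `|K₂(ω)| ≤ 16/π²`
(`IsTorusLimitOf.abs_meanEnergy_diagHop_le`) give
`c + κ(u − u') − Σₖ ‖aₖ‖ + (Σ_σ μ_σ)(n/2 − ν) − |t'_A − t'_P|·(16κ/π² + ‖W_{t'}‖)
   − |U_A − U_P|·(κ(n/2)² + ‖W_U‖) ≤ Re ω_{Λ'}(Xw)`: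
the certified word of the anchor is Lipschitz in the couplings with these explicit constants (plus the cap
re-booking `κ(u − u')`). [cite: WangEtAl2024, §III] [cite: LiebLoss1993, §8, Theorem 8.2] -/
theorem IsTorusLimitOf.re_expect_ge_of_window_certificate_TT'_ineq_transport_lipschitz
    (t t'A UA t'P : ℝ) {UP : ℝ} (hUP : 0 < UP) {n : ℝ} (hn0 : 0 ≤ n) (hn2 : n < 2) {κ u u' : ℝ}
    (hκ : 0 ≤ κ) (hu' : ThermodynamicLimit.energyDensityTT' t t'P UP n ≤ u')
    {Λ Λ' : Finset (Site 2)} (hΛ : Λ ⊆ Λ') (h8 : thicken Λ 1 ⊆ Λ')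
    (h0 : thicken ({0} : Finset (Site 2)) 1 ⊆ Λ') (hz : (0 : Site 2) ∈ Λ')
    (Xw : FermionOp Λ') (μ : Fin 2 → ℝ) (ν : ℝ)
    {m : Type*} [Fintype m] [DecidableEq m] {Λm : Matrix m m ℂ} (hΛm : Λm.PosSemidef)
    (O : m → FermionOp Λ')
    {κ' : Type*} (s : Finset κ') (B : κ' → FermionOp Λ)
    {ι : Type*} (tt : Finset ι) (γ : ι → DihedralGroup 4) (hγ1 : ∀ l ∈ tt, γ l = 1) (wv : ι → Site 2)
    (hsh : ∀ l, d4ShiftSet (γ l) (wv l) Λ ⊆ Λ') (Y : ι → FermionOp Λ)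
    {ρ : Type*} (uu : Finset ρ) (b : ρ → ℂ) (cw : ρ → List (Orb (PolySite Λ') × Bool))
    (hcw : ∀ j ∈ uu, ladderCharge (cw j) ≠ 0 ∨ ladderSpinCharge (cw j) ≠ 0)
    {δ : Type*} (ah : Finset δ) (dc : δ → ℝ) (V : δ → FermionOp Λ')
    {κ'' : Type*} (w : Finset κ'') (a : κ'' → ℂ) (word : κ'' → List (Orb (PolySite Λ') × Bool)) {c : ℝ}
    (hcert : Xw - (c : ℂ) • (1 : FermionOp Λ') -
        ∑ σ : Fin 2, ((μ σ : ℝ) : ℂ) • (nAt 0 hz σ - ((ν : ℝ) : ℂ) • (1 : FermionOp Λ')) -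
        ((κ : ℝ) : ℂ) • (((u : ℝ) : ℂ) • (1 : FermionOp Λ') -
          fermionEmbed (PolySite.incl h0) ((hubbardTTPrimeFermionInteraction t t'A UA).meanEnergyObs 1)) =
      gramForm Λm O +
        (∑ k ∈ s, ((hubbardTTPrimeFermionInteraction t t'A UA).localHamiltonian Λ' * fermionEmbed (PolySite.incl hΛ) (B k) -
            fermionEmbed (PolySite.incl hΛ) (B k) * (hubbardTTPrimeFermionInteraction t t'A UA).localHamiltonian Λ') +
          ∑ l ∈ tt, (fermionEmbed (PolySite.incl (hsh l)) (fermionEmbed (PolySite.d4Emb (γ l) (wv l) Λ) (Y l)) -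
            fermionEmbed (PolySite.incl hΛ) (Y l)) +
          ∑ j ∈ uu, b j • ladderWord (cw j)) +
        (∑ m' ∈ ah, ((dc m' : ℝ) : ℂ) • ((V m')ᴴ - V m') + ∑ k ∈ w, a k • ladderWord (word k)))
    {Ls : ℕ → ℕ} (hLs : Tendsto Ls atTop atTop)
    {ψ : ∀ L, Fock (Orb (FermionTorus 2 L))}
    (hψ : ∀ j, IsGroundStateInSector (hubbardTorusTT' (Ls j) t t'P UP)
      (ThermodynamicLimit.rectN n (Ls j)) 0 (ψ (Ls j)))
    (hψ1 : ∀ j, star (ψ (Ls j)) ⬝ᵥ ψ (Ls j) = 1)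
    {ω : InfVolFermionState 2} (hω : ω.IsTorusLimitOf ψ Ls) :
    c + κ * (u - u') - ∑ k ∈ w, ‖a k‖ + (∑ σ : Fin 2, μ σ) * (n / 2 - ν) -
        |t'A - t'P| * (κ * (16 / Real.pi ^ 2) + ‖∑ k ∈ s,
          ((hubbardTTPrimeFermionInteraction 0 1 0).localHamiltonian Λ' * fermionEmbed (PolySite.incl hΛ) (B k) -
            fermionEmbed (PolySite.incl hΛ) (B k) * (hubbardTTPrimeFermionInteraction 0 1 0).localHamiltonian Λ')‖) -
        |UA - UP| * (κ * (n / 2) ^ 2 + ‖∑ k ∈ s,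
          ((hubbardTTPrimeFermionInteraction 0 0 1).localHamiltonian Λ' * fermionEmbed (PolySite.incl hΛ) (B k) -
            fermionEmbed (PolySite.incl hΛ) (B k) * (hubbardTTPrimeFermionInteraction 0 0 1).localHamiltonian Λ')‖) ≤
      (ω.expect Λ' Xw).re := by
  have hN : ∀ j, IsNParticle (rectN n (Ls j)) (ψ (Ls j)) := fun j => ((mem_szSector_iff _ _ _).1 (hψ j).1).1
  have hK := abs_le.1 (hω.abs_meanEnergy_diagHop_le hn0 hn2 hLs hN hψ1)
  have hd0 : 0 ≤ (ω.expect ({0} : Finset (Site 2))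
      (nAt 0 (Finset.mem_singleton_self 0) 0 * nAt 0 (Finset.mem_singleton_self 0) 1)).re :=
    ω.re_expect_docc_nonneg
  have hd1 := hω.re_expect_docc_le_sq_half_density_of_groundState t t'P hUP hn0 hn2 hLs hψ hψ1
  have h := hω.re_expect_ge_of_window_certificate_TT'_ineq_transport_priced t t'A UA t'P hUP.le hn0 hn2 hκ hu'
    hΛ h8 h0 hz Xw μ ν hΛm O s B tt γ hγ1 wv hsh Y uu b cw hcw ah dc V w a word hcert hLs hψ hψ1
    ⟨hK.1, hK.2⟩ ⟨hd0, hd1⟩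
  -- the two `max` terms are bounded by the symmetric Lipschitz constants
  have hT : max ((t'A - t'P) * κ * (-(16 / Real.pi ^ 2))) ((t'A - t'P) * κ * (16 / Real.pi ^ 2)) ≤
      |t'A - t'P| * (κ * (16 / Real.pi ^ 2)) := by
    have hc : 0 ≤ κ * (16 / Real.pi ^ 2) := mul_nonneg hκ (by positivity)
    refine max_le ?_ ?_
    · have : (t'A - t'P) * κ * (-(16 / Real.pi ^ 2)) = (-(t'A - t'P)) * (κ * (16 / Real.pi ^ 2)) := by ring
      rw [this]
      exact mul_le_mul_of_nonneg_right (neg_le_abs _) hc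
    · rw [mul_assoc]
      exact mul_le_mul_of_nonneg_right (le_abs_self _) hc
  have hD : max ((UA - UP) * κ * 0) ((UA - UP) * κ * (n / 2) ^ 2) ≤ |UA - UP| * (κ * (n / 2) ^ 2) := by
    have hc : 0 ≤ κ * (n / 2) ^ 2 := mul_nonneg hκ (sq_nonneg _)
    refine max_le ?_ ?_
    · rw [mul_zero]
      exact mul_nonneg (abs_nonneg _) hc
    · rw [mul_assoc]
      exact mul_le_mul_of_nonneg_right (le_abs_self _) hc
  nlinarith [hT, hD, h, norm_nonneg (∑ k ∈ s,
      ((hubbardTTPrimeFermionInteraction 0 1 0).localHamiltonian Λ' * fermionEmbed (PolySite.incl hΛ) (B k) -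
        fermionEmbed (PolySite.incl hΛ) (B k) * (hubbardTTPrimeFermionInteraction 0 1 0).localHamiltonian Λ')),
    norm_nonneg (∑ k ∈ s,
      ((hubbardTTPrimeFermionInteraction 0 0 1).localHamiltonian Λ' * fermionEmbed (PolySite.incl hΛ) (B k) -
        fermionEmbed (PolySite.incl hΛ) (B k) * (hubbardTTPrimeFermionInteraction 0 0 1).localHamiltonian Λ'))]

end InfVolFermionState

end Literature.MathematicalPhysics.QuantumLattice
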